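import Summits.Ventures.PackingBounds.ThreePointCert.K13d14pAggG1
import Summits.Ventures.PackingBounds.ThreePointCert.K13d14pAggG2
import Summits.Ventures.PackingBounds.ThreePointCert.K13d14pAggG3
import Summits.Ventures.PackingBounds.ThreePointCert.K13d14pAggP
import Summits.Ventures.PackingBounds.ThreePointCert.CheckKSP

/-!
# κ(13) ≤ 2069: kernel validation (Kronecker substitution) of Gram blocks/parts R2 (29334 factor entries; part 7 of 9)

Framing: lottery ticket; floor = certified bounds/negative ranges. Venture `PackingBounds` (cell
`pub-packcert`), three-point SDP family, kissing column. Integer data / kernel checks of a feasible point of the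
Bachoc–Vallentin semidefinite program (n = 13, s = 1/2, three-point matrix degree 14, two-point (Gegenbauer) part to
degree L = 28, Bachoc–Vallentin multiplier set = cell mode sym2; exact rational certificate `sdp-n13-d14-s1-2-sym2-a28-hyb8dd-j155390.json`
(sha256 f3bd2120ef6b3f7462b1c9710407160f3cb5333468dd4a4a85b403a137826c8c) of the sdp seat's hybrid pipeline, verified by the cell's two exact verifiers), converted by
`cert2lean_g9.py` (lp gen 9; S = 74) into the units of the kernel checker `ThreePointCert.Check` + `CheckSym2` with the
record degree field set to L = 28 (the checker's degree enters only the unit `W = 2^d·d!` and the side conditions, so a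
(d, L) certificate is a `Cert3` of degree L); symmetry-adapted PARTS (S₃/S₂ isotypic bases of short polynomials) with coarse factor COLUMNS, validated by
Kronecker substitution `ThreePointCert.CheckKSP` (`sosCheckKSParts`: the claimed expansion and `Σ_parts Σ_k col_k²` compared at `(2^w, 2^{wD}, 2^{wD²})`); three-point part by `CheckFKS`;
split check of (ii') `ThreePointCert.CheckSym2Split`. Emitter `emitlean_ks3.py` (lp gen 10; expansions `4^k • Σ_parts pᵀ(L′L′ᵀ)p` lifted by `SoundNN.boxNonneg_smul`). Generated file: plain lists of integers / monomials.
-/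

namespace Summit.Ventures.PackingBounds.ThreePointCert.K13d14p

open Literature.Geometry.DiscreteGeometry Literature.Geometry.DiscreteGeometry.PolyCert PolyCert.SPoly

set_option maxRecDepth 100000 in
set_option maxHeartbeats 0 in
/-- Block `R2` (multiplier q²·s₂): the unscaled expansion `eR2s` IS `Σ_parts Σ_k col_k²` — Kronecker-substitution check at `(2^192, 2^(192·25), 2^(192·25²))` over the symmetry-adapted parts (kernel; 29334 factor entries). -/
theorem vR2 : sosCheckKSParts 192 25 1 K13d14p.partsR2 K13d14p.eR2s = true := by
  decide +kernel

end Summit.Ventures.PackingBounds.ThreePointCert.K13d14p
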